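import Literature.Barriers.AtomisticToContinuum.StrongPinningBreathersLyapunov
import Literature.MathematicalPhysics.KineticTheory.LangevinChainExpBound
import HarnessLib

/-!
# Narrowed barrier `StrongPinningBreathersNarrow` (barrier audit of `StrongPinningBreathers`, 2026-08-15)

`Literature/Barriers/AtomisticToContinuum/` (D-0021 catalogue), sub-problem `FouriersLaw`. Audit of
the BARRIER block carried by `HairerMattingly2009_threeOscillators` (`StrongPinningBreathers.lean`,
"pinning stronger than coupling — breathers, no spectral gap"; catalogued technique class
`exponential-lyapunov-function geometric-drift-harris spectral-gap-hypocoercivity compact-resolvent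
weighted-L2-spectral-gap exponential-ergodicity`). Outcome: NARROWED (technique class and scope),
status CONFIRMED; every conjunct of the narrowed statement is PROVED here and no named fact is
introduced (D-0026).

## Sources re-read (arXiv versions, page level)

* M. Hairer, J. C. Mattingly, *Slow energy dissipation in anharmonic oscillator chains*, Comm. Pure
  Appl. Math. **62** (2009) 999–1032, arXiv:0712.3884 [HM]: Abstract; §1; §2 (the decay law
  `Ḣ ≈ -(γ₀+γ₂)κ_k H^{2/k-1}` for three oscillators and `Ḣ ≈ -(γ₀+γ_N)κ_{k,n}H^{2n/k+1-2n}` for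
  `2n+1` oscillators; even chains "similar"); §2.2 (model exponent `γ = 2n/k + 1 - 2n`, "since
  `k > 1` … one has always `γ < 1`"; Claim 2: `0 < γ < 1` compact resolvent, `γ = 0` "does not have
  compact resolvent, but it still has a spectral gap", `γ < 0` "`0` belongs to the essential
  spectrum"; then: "It is then a natural conjecture that the spectrum of the generator … on the `L²`
  space weighted by the invariant measure has the same behavior … The next section is a step
  towards a proof of this conjecture"); §3 Def 3.1 (`λ ∈ σ_e(T)` iff `T - λ` is not semi-Fredholm,
  "the strongest" notion); §3.2 (spaces `L²(e^{-βH}dp dq)`, `β < 2 min{β₀, β₂}`: "it is not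
  expected that the qualitative nature of the spectrum of `L` depends on the choice of `β` … it is
  very likely that the qualitative nature of the spectrum of `L` in `L²(μ)` is also the same";
  Rem 3.10; Thm 3.11; Rem 3.12); §3.3 Thm 3.13; §5 Prop 5.1, Rem 5.2, Rem 5.4 ("one could also
  apply Itô's formula to `exp(θ𝒰₀)` … and obtain `L exp(θ𝒰₀) ≤ C - α exp(θ𝒰₀)`", for the
  corrected OUTER energies `𝒰₀`), Thm 5.6 and its proof (`L𝒰₁ ≤ -cH^{n+2/k-2} + C𝒰₀^N` for
  `3/2 < k < 2`).
* M. Hairer, *How hot can a heat bath get?*, Comm. Math. Phys. **292** (2009) 131–177,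
  arXiv:0810.5431 [H09]: §1 ("It was shown in [HM] that this can lead in many cases to a loss of
  compactness of the semigroup generated by the dynamic and the appearance of essential spectrum
  at `1`"); Thm 1.1 (two oscillators, one bath at infinite temperature: no invariant probability
  measure for `k > 2`; algebraic rate at `k = 2`, `T_∞ < α²Ĉ`; stretched exponential for
  `4/3 ≤ k < 2`; EXPONENTIAL for `1 < k ≤ 4/3` — with matching upper and lower bounds); §3.3 (the
  lower-bound criterion).
* N. Cuneo, J.-P. Eckmann, M. Hairer, L. Rey-Bellet, Electron. J. Probab. **23** (2018) no. 55,
  arXiv:1712.09413, §1 (paragraph after condition C5).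
* N. Cuneo, C. Poquet, Electron. Commun. Probab. **22** (2017) no. 35, arXiv:1604.03408, §1
  ("chains of oscillators where the pinning dominates the interactions can exhibit strictly
  subgeometric rates, as proved in [HM]") and Thm 1.1 (a total-variation LOWER bound `e^{-c√t}` for
  two rotors, by the method of [H09]).
* A. V. Dymov, L. V. Lokutsievskiy, A. V. Sarychev, Proc. Steklov Inst. Math. **327** (2024) 78–95,
  arXiv:2406.19499, §5 ("In the opposite case when the pinning dominates, the mixing is proven only
  for a chain of `N = 3` oscillators [HM]"; their deterministic strict Lyapunov function "does not
  allow to prove mixing even for the chain of 3 rotators coupled to thermal baths").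
* J. Lu, arXiv:2607.13953 (2026), §1 (state of the art: fixed-`N` ergodicity under the
  Eckmann–Hairer / Rey-Bellet–Thomas / Carmona / CEHR growth conditions).

## Findings

1. TECHNIQUE CLASS — narrowed. The printed no-go theorems [HM Thm 3.11, Rem 3.12, Thm 3.13] are
   statements about the conjugated generator `L̃` on the Gibbs-weighted Hilbert spaces
   `L²(e^{-βH}dp dq)`, `β < 2 min{β₀, β_N}`: no compact resolvent, resp. `0 ∈ σ_e(L̃)` (so `0` is
   not an isolated eigenvalue of finite multiplicity and the semigroup has no exponentially stable
   invariant complement of finite codimension IN THOSE SPACES). They do not quantify over (i) the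
   spectral gap in `L²(μ)` of the true steady state — a CONJECTURE of the source (§2.2, §3.2);
   (ii) `V`-uniform (Harris) geometric ergodicity in weighted total variation, for `V = e^{θH}` or
   any other weight, nor over LOWER bounds on `‖P_t(x,·) - μ‖_TV`: that technology exists [H09 §3.3,
   Cuneo–Poquet 2017] but is printed only for the two-oscillator model with an infinite-temperature
   bath [H09 Thm 1.1] and for rotor chains; the abstract's "does not relax exponentially fast" and
   the community reading "strictly subgeometric rates, as proved in [HM]" refer to the weighted-`L²`
   statement. (iii) A POINTWISE generator drift `LV ≤ C - cH^α` for an energy-only `V = F(H)`,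
   `F' ≥ 0` on `[0, ∞)`, fails for EVERY chain — strongly pinned or not, C5 or not — by the identity
   `L(F∘H)(q, 0) = γ(T_L + T_R)F'(H(q, 0)) ≥ 0` (proved here for the tree's `generator`): the
   exponential-Lyapunov technique of CEHR 2018 is a TIME-INTEGRATED bound, and it is the integrated
   dissipation `∫₀ᵗ ∑ γ p_b²` that a breather suppresses (`Ḣ ≈ -cH^{γ(k,n)}`).
2. SCOPE — sharpened to a regime map. With `γ(k,n) = 2n/k + 1 - 2n` and `n = ⌊(N-1)/2⌋` the number
   of bonds from the most central site of an `N`-site chain to the nearest bath: `γ < 1 ↔ k > 1`;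
   `γ < 0 ↔ k > 2n/(2n-1)` (thresholds `2, 4/3, 6/5, …`). PRINTED: `N ∈ {3, 4}`: `k ≥ 2` no compact
   resolvent, `k > 2` `0 ∈ σ_e` [Thm 3.11, Rem 3.12]; `N ≥ 5`: `k > 3/2` `0 ∈ σ_e`, `k = 3/2` no
   compact resolvent [Thm 3.13]. NOT PRINTED (no theorem either way): `N ∈ {3, 4}` with
   `1 < k < 2`, where the model PREDICTS a compact resolvent; `N ≥ 5` with `1 < k < 3/2` (model:
   gapless iff `k > 2n/(2n-1)`, and `2n/(2n-1) ≤ 4/3 < 3/2`); the `φ⁴` chain (`k = 2`): for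
   `N ∈ {3, 4}` only compactness is lost and a SPECTRAL GAP IS PREDICTED (`γ(2,1) = 0`), for `N ≥ 5`
   `0 ∈ σ_e` is proved (`γ(2,2) = -1`). The theorems are printed for the homogeneous pinning
   `|q|^{2k}/2k` — for `phi4Chain 0 1 γ = homogeneouslyPinnedChain 2 γ` and no other member of the
   family `phi4Chain ω₂ lam γ` (`ω₂ > 0` only via the expectation of Rem 2.2).
3. STATUS — confirmed. Existence of the steady state for `N ≥ 4` strongly pinned oscillators is
   open as of 2024–2026 [Dymov–Lokutsievskiy–Sarychev 2024 §5; Lu 2026 §1]. Searched 2026-08-15: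
   zbMATH ("anharmonic chain steady state", "oscillators pinning Langevin", "breathers dissipation
   chain", "rotors heat baths", "chain oscillators nonequilibrium", 2010–), the local citation
   graph of [HM] (71 citing works, `lit citing` / `lit related`) and the Explorer corpora: no
   existence, rate or lower-bound theorem for finite-temperature strongly pinned chains beyond
   [HM] (related negatives: two particles with one damped site heat up without bound — Dolgopyat et
   al., Nonlinearity 2025, arXiv:2312.01207, Thm 1.1; deterministic decay laws — Eckmann–Wayne 2020,
   Dymov–Lokutsievskiy–Sarychev 2024).

## Contents (all PROVED)

* `breatherDecayExponent k n = 2n/k + 1 - 2n`, `centralDepth N = (N-1)/2` and the regime-map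
  lemmas `breatherDecayExponent_lt_one_iff`, `_neg_iff`, `_pos_iff`, `_two_one`, `_two_two`,
  `_neg_of_lt`, `exists_breatherDecayExponent_neg`, `threshold_le_four_thirds`.
* `phi4Chain_eq_homogeneouslyPinnedChain_two_iff`.
* `OscillatorChain.generator_comp_hamiltonian_zero_momenta`,
  `OscillatorChain.not_generator_comp_hamiltonian_le` (any chain) and the instances
  `homogeneouslyPinnedChain_not_generator_comp_hamiltonian_le`,
  `pinnedChain_not_generator_comp_hamiltonian_le`, `homogeneouslyPinnedChain_not_generator_exp_le`.
* `StrongPinningBreathersNarrow` (the conjunction) and `StrongPinningBreathersNarrow_holds`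
  (axioms `propext, Classical.choice, Quot.sound`).
-/

noncomputable section

open MeasureTheory Filter Topology
open scoped ContDiff

namespace Literature.Barriers.AtomisticToContinuum.HeatConduction

open Literature.MathematicalPhysics.KineticTheory.HeatConduction

/-! ### Hairer–Mattingly's energy-decay exponent and the regime map -/

/-- HM 2009 §2, eq. for `Ḣ` of a chain of length `2n+1` ("the energy of the system decreases like
`Ḣ(t) ≈ -(γ₀ + γ_N) κ_{k,n} H(t)^{2n/k + 1 - 2n}`") and §2.2 eq. (e:model) (`γ = 2n/k + 1 - 2n`):
the (heuristic) ENERGY-DECAY EXPONENT of a breather sitting `n` bonds away from the nearest bath in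
a chain with pinning `|q|^{2k}/2k` and harmonic coupling. [cite: HairerMattingly2009, §2.2 Claim 2] -/
def breatherDecayExponent (k : ℝ) (n : ℕ) : ℝ := 2 * n / k + 1 - 2 * n

/-- The number of bonds between the most central site of an `N`-site chain (sites `0,…,N-1`, baths
on `0` and `N-1`) and its nearest bath: `⌊(N-1)/2⌋` (`N = 3, 4 ↦ 1`; `N = 5, 6 ↦ 2`) — the `n` of
HM §2 for `N = 2n+1`, and of Rem 3.12 / §2 ("even chains") for `N = 2n+2`. [cite: HairerMattingly2009, Rem 3.12] -/
def centralDepth (N : ℕ) : ℕ := (N - 1) / 2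

/-- `centralDepth 3 = 1`. [folklore] -/
theorem centralDepth_three : centralDepth 3 = 1 := rfl

/-- `centralDepth 4 = 1` (Rem 3.12: four oscillators behave like three). [cite: HairerMattingly2009, Rem 3.12] -/
theorem centralDepth_four : centralDepth 4 = 1 := rfl

/-- `centralDepth 5 = 2` (Thm 3.13's shortest chain). [cite: HairerMattingly2009, Thm 3.13] -/
theorem centralDepth_five : centralDepth 5 = 2 := rfl

/-- `centralDepth 6 = 2`. [folklore] -/
theorem centralDepth_six : centralDepth 6 = 2 := rfl

/-- Unfolding. [folklore] -/
theorem breatherDecayExponent_def (k : ℝ) (n : ℕ) :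
    breatherDecayExponent k n = 2 * n / k + 1 - 2 * n := rfl

/-- **Pinning stronger than coupling ⇔ sub-exponential breather decay law**: for `k > 0`, `n ≥ 1`,
`γ(k,n) < 1 ↔ k > 1` ("since `k > 1` … one has always `γ < 1`", HM §2.2). [cite: HairerMattingly2009, §2.2 eq. (e:model)] -/
theorem breatherDecayExponent_lt_one_iff {k : ℝ} (hk : 0 < k) {n : ℕ} (hn : 1 ≤ n) :
    breatherDecayExponent k n < 1 ↔ 1 < k := by
  have hn' : (0 : ℝ) < n := by exact_mod_cast hn
  rw [breatherDecayExponent_def]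
  constructor
  · intro h
    have h1 : 2 * (n : ℝ) / k < 2 * n := by linarith
    rw [div_lt_iff₀ hk] at h1
    nlinarith
  · intro h
    have h1 : 2 * (n : ℝ) / k < 2 * n := by
      rw [div_lt_iff₀ hk]
      nlinarith
    linarith

/-- **The algebraic regime** (`γ < 0`: `0` in the essential spectrum of the model operator, HM §2.2
Claim 2, third bullet): for `k > 0`, `n ≥ 1`, `γ(k,n) < 0 ↔ k > 2n/(2n-1)` — thresholds `2`
(`n = 1`: three or four oscillators, Thm 3.11), `4/3` (`n = 2`), `6/5`, … . [cite: HairerMattingly2009, §2.2 Claim 2] -/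
theorem breatherDecayExponent_neg_iff {k : ℝ} (hk : 0 < k) {n : ℕ} (hn : 1 ≤ n) :
    breatherDecayExponent k n < 0 ↔ 2 * n / (2 * n - 1) < k := by
  have hn' : (1 : ℝ) ≤ n := by exact_mod_cast hn
  have hd : (0 : ℝ) < 2 * n - 1 := by linarith
  rw [breatherDecayExponent_def, div_lt_iff₀ hd]
  constructor
  · intro h
    have h1 : 2 * (n : ℝ) / k < 2 * n - 1 := by linarith
    rw [div_lt_iff₀ hk] at h1
    linarith
  · intro h
    have h1 : 2 * (n : ℝ) / k < 2 * n - 1 := by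
      rw [div_lt_iff₀ hk]
      linarith
    linarith

/-- **The compact-resolvent regime** (`0 < γ < 1`, HM §2.2 Claim 2, first bullet): for `k > 0`,
`n ≥ 1`, `0 < γ(k,n) ↔ k < 2n/(2n-1)`. [cite: HairerMattingly2009, §2.2 Claim 2] -/
theorem breatherDecayExponent_pos_iff {k : ℝ} (hk : 0 < k) {n : ℕ} (hn : 1 ≤ n) :
    0 < breatherDecayExponent k n ↔ k < 2 * n / (2 * n - 1) := by
  have hn' : (1 : ℝ) ≤ n := by exact_mod_cast hn
  have hd : (0 : ℝ) < 2 * n - 1 := by linarith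
  rw [breatherDecayExponent_def, lt_div_iff₀ hd]
  constructor
  · intro h
    have h1 : 2 * (n : ℝ) - 1 < 2 * n / k := by linarith
    rw [lt_div_iff₀ hk] at h1
    linarith
  · intro h
    have h1 : 2 * (n : ℝ) - 1 < 2 * n / k := by
      rw [lt_div_iff₀ hk]
      linarith
    linarith

/-- **The `φ⁴` chain with three or four sites is the borderline `γ = 0`** (`k = 2`, `n = 1`): "the
operator does not have compact resolvent, but it still has a spectral gap" is the model prediction
(HM §2.2 Claim 2, second bullet); Thm 3.11 proves the non-compactness half. [cite: HairerMattingly2009, §2.2 Claim 2] -/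
theorem breatherDecayExponent_two_one : breatherDecayExponent 2 1 = 0 := by
  norm_num [breatherDecayExponent_def]

/-- **The `φ⁴` chain with five or more sites is in the algebraic regime** (`k = 2`, `n = 2`:
`γ = -1 < 0`; Thm 3.13 proves `0 ∈ σ_e`). [cite: HairerMattingly2009, Thm 3.13] -/
theorem breatherDecayExponent_two_two : breatherDecayExponent 2 2 = -1 := by
  norm_num [breatherDecayExponent_def]

/-- **Every strongly pinned chain is eventually in the algebraic regime**: for `k > 1` and every
depth `n > k/(2(k-1))`, `γ(k,n) < 0`. [cite: HairerMattingly2009, §2 eq. for `Ḣ` of a chain of length `2n+1`] -/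
theorem breatherDecayExponent_neg_of_lt {k : ℝ} (hk : 1 < k) {n : ℕ} (hn : k / (2 * (k - 1)) < n) :
    breatherDecayExponent k n < 0 := by
  have hk1 : 0 < 2 * (k - 1) := by linarith
  rw [div_lt_iff₀ hk1] at hn
  have hnN : 0 < n := by
    rcases Nat.eq_zero_or_pos n with h | h
    · subst h
      norm_num at hn
      linarith
    · exact h
  have hn1 : (1 : ℝ) ≤ n := by exact_mod_cast hnN
  rw [breatherDecayExponent_neg_iff (by linarith) hnN]
  have hd : (0 : ℝ) < 2 * n - 1 := by linarith
  rw [div_lt_iff₀ hd]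
  nlinarith

/-- For `k > 1` there is a depth `n ≥ 1` with `γ(k,n) < 0` (chains with `N ≥ 2n+1` sites).
[cite: HairerMattingly2009, §2 eq. for `Ḣ` of a chain of length `2n+1`] -/
theorem exists_breatherDecayExponent_neg {k : ℝ} (hk : 1 < k) :
    ∃ n : ℕ, 1 ≤ n ∧ breatherDecayExponent k n < 0 := by
  refine ⟨⌈k / (2 * (k - 1))⌉₊ + 1, by omega, breatherDecayExponent_neg_of_lt hk ?_⟩
  push_cast
  have := Nat.le_ceil (k / (2 * (k - 1)))
  linarith

/-- The heuristic thresholds `2n/(2n-1)` for `n ≥ 2` are at most `4/3`, strictly inside Thm 3.13's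
printed hypothesis `k > 3/2`: the window `2n/(2n-1) < k ≤ 3/2` (`N ≥ 5` sites) is predicted
gapless but covered by no printed theorem. [cite: HairerMattingly2009, Thm 3.13] -/
theorem threshold_le_four_thirds {n : ℕ} (hn : 2 ≤ n) : (2 * n : ℝ) / (2 * n - 1) ≤ 4 / 3 := by
  have hn' : (2 : ℝ) ≤ n := by exact_mod_cast hn
  have hd : (0 : ℝ) < 2 * n - 1 := by linarith
  rw [div_le_div_iff₀ hd (by norm_num : (0 : ℝ) < 3)]
  linarith

/-! ### Which member of the `φ⁴` family the printed theorems are about -/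

/-- **The printed no-go theorems concern exactly the `ω₂ = 0`, `lam = 1` member of the `φ⁴`
family**: `phi4Chain ω₂ lam γ' = homogeneouslyPinnedChain 2 γ ↔ ω₂ = 0 ∧ lam = 1 ∧ γ' = γ`
(non-homogeneous pinning `ω₂ > 0` enters HM 2009 only through the expectation of Rem 2.2).
[cite: HairerMattingly2009, Rem 2.2] -/
theorem phi4Chain_eq_homogeneouslyPinnedChain_two_iff (ω₂ lam γ γ' : ℝ) :
    phi4Chain ω₂ lam γ' = homogeneouslyPinnedChain 2 γ ↔ ω₂ = 0 ∧ lam = 1 ∧ γ' = γ := by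
  constructor
  · intro h
    have hU1 : (phi4Chain ω₂ lam γ').U 1 = (homogeneouslyPinnedChain 2 γ).U 1 := by rw [h]
    have hU2 : (phi4Chain ω₂ lam γ').U 2 = (homogeneouslyPinnedChain 2 γ).U 2 := by rw [h]
    have hγ : (phi4Chain ω₂ lam γ').γ = (homogeneouslyPinnedChain 2 γ).γ := by rw [h]
    rw [homogeneouslyPinnedChain_two_U] at hU1 hU2
    simp only [phi4Chain] at hU1 hU2 hγ
    refine ⟨?_, ?_, ?_⟩
    · nlinarith
    · nlinarith
    · exact hγ
  · rintro ⟨rfl, rfl, rfl⟩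
    exact (homogeneouslyPinnedChain_two γ').symm

end Literature.Barriers.AtomisticToContinuum.HeatConduction

/-! ### Energy-only Lyapunov functions never satisfy a pointwise generator drift -/

namespace Literature.MathematicalPhysics.KineticTheory.HeatConduction.OscillatorChain

variable (P : OscillatorChain) {N : ℕ}

/-- With nonnegative potentials the energy dominates each pinning term: `U(q_i) ≤ H(q, p)`.
[folklore] -/
theorem apply_U_le_hamiltonian (hU : ∀ q, 0 ≤ P.U q) (hV : ∀ r, 0 ≤ P.V r) (x : PhaseSpace N)
    (i : Fin N) : P.U (x.1 i) ≤ P.hamiltonian N x := by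
  unfold hamiltonian
  have hS2 : 0 ≤ ∑ i : Fin N, ∑ j : Fin N, (if j.val = i.val + 1 then P.V (x.1 j - x.1 i) else 0) :=
    Finset.sum_nonneg fun i _ => Finset.sum_nonneg fun j _ => by
      split_ifs
      · exact hV _
      · exact le_rfl
  have hterm : ∀ j : Fin N, 0 ≤ x.2 j ^ 2 / 2 + P.U (x.1 j) := fun j => by
    have := hU (x.1 j)
    positivity
  have hle : x.2 i ^ 2 / 2 + P.U (x.1 i) ≤ ∑ j, (x.2 j ^ 2 / 2 + P.U (x.1 j)) :=
    Finset.single_le_sum (f := fun j => x.2 j ^ 2 / 2 + P.U (x.1 j)) (fun j _ => hterm j)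
      (Finset.mem_univ i)
  have hp : 0 ≤ x.2 i ^ 2 / 2 := by positivity
  linarith

/-- **`L(F∘H)` at zero momenta is pure heating**: for every chain with differentiable energy and
`N ≥ 1` sites, `L(F∘H)(q, 0) = γ (T_L + T_R) F'(H(q, 0))` — the Hamiltonian part vanishes on
functions of `H`, the friction terms `-γ p_b ∂_{p_b}` vanish at `p_b = 0`, and only the Itô terms
`γ T_b ∂²_{p_b} F(H) = γ T_b F'(H)` survive (CEHR 2018 eq. (3.3) evaluated at `p = 0`).
[cite: CuneoEckmannHairerReyBellet2018, §3 eq. (3.3)] -/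
theorem generator_comp_hamiltonian_zero_momenta (hN : 0 < N)
    (hH : Differentiable ℝ (P.hamiltonian N)) {F F' F'' : ℝ → ℝ}
    (hF : ∀ u, HasDerivAt F (F' u) u) (hF' : ∀ u, HasDerivAt F' (F'' u) u) (T_L T_R : ℝ)
    (q : Fin N → ℝ) :
    P.generator N T_L T_R (fun y => F (P.hamiltonian N y)) (q, 0) =
      P.γ * (T_L + T_R) * F' (P.hamiltonian N (q, 0)) := by
  rw [P.generator_comp_hamiltonian hH hF hF']
  have h0 : ∀ i : Fin N, (i.val = 0) ↔ i = ⟨0, hN⟩ := fun i => by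
    simp [Fin.ext_iff]
  have h1 : ∀ i : Fin N, (i.val = N - 1) ↔ i = ⟨N - 1, Nat.sub_lt hN one_pos⟩ := fun i => by
    simp [Fin.ext_iff]
  simp only [Pi.zero_apply, h0, h1]
  rw [Finset.sum_add_distrib, Finset.sum_ite_eq' Finset.univ, Finset.sum_ite_eq' Finset.univ]
  simp only [Finset.mem_univ, if_true]
  ring

/-- **No energy-only Lyapunov function has a pointwise generator drift, for ANY chain.** If the
potentials are `C¹` and nonnegative, the pinning is unbounded above, `γ > 0`, `T_L + T_R > 0` and
`F' ≥ 0` on `[0, ∞)`, then NO bound `L(F∘H) ≤ C - c H^α` (`c, α > 0`) holds on phase space: at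
the zero-momentum configurations `(s, …, s; 0)` with `U(s)` large, `L(F∘H) = γ(T_L+T_R)F'(H) ≥ 0`
while `C - cH^α < 0`. This holds for the conjunct's `pinnedChain` (condition C5) and for the
Hairer–Mattingly chain alike: "exponential Lyapunov function" arguments for Langevin chains are
TIME-INTEGRATED drift bounds (`P^t V ≤ λV + b` from the integrated dissipation `∫₀ᵗ ∑ γ p_b² ds`),
never pointwise ones — and it is the integrated dissipation that a breather suppresses. [folklore] -/
theorem not_generator_comp_hamiltonian_le (hN : 0 < N) (hU : ContDiff ℝ 1 P.U)
    (hV : ContDiff ℝ 1 P.V) (hU0 : ∀ q, 0 ≤ P.U q) (hV0 : ∀ r, 0 ≤ P.V r)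
    (hUunb : ∀ E : ℝ, ∃ s : ℝ, E ≤ P.U s) (hγ : 0 < P.γ) {T_L T_R : ℝ} (hT : 0 < T_L + T_R)
    {F F' F'' : ℝ → ℝ} (hF : ∀ u, HasDerivAt F (F' u) u) (hF' : ∀ u, HasDerivAt F' (F'' u) u)
    (hF'0 : ∀ u, 0 ≤ u → 0 ≤ F' u) {C c α : ℝ} (hc : 0 < c) (hα : 0 < α) :
    ¬ ∀ x, P.generator N T_L T_R (fun y => F (P.hamiltonian N y)) x ≤
        C - c * P.hamiltonian N x ^ α := by
  intro h
  have hH : Differentiable ℝ (P.hamiltonian N) :=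
    (P.contDiff_hamiltonian hU hV N).differentiable (by norm_num)
  -- the energy level above which `C - cH^α < 0`
  set R : ℝ := ((|C| + 1) / c) ^ (1 / α) with hR
  have hR0 : 0 ≤ R := Real.rpow_nonneg (by positivity) _
  obtain ⟨s, hs⟩ := hUunb R
  -- the zero-momentum configuration `x = (s, …, s; 0, …, 0)`
  have hHx : R ≤ P.hamiltonian N ((fun _ => s), 0) :=
    hs.trans (P.apply_U_le_hamiltonian hU0 hV0 ((fun _ => s), 0) ⟨0, hN⟩)
  have hHx0 : 0 ≤ P.hamiltonian N ((fun _ => s), 0) := hR0.trans hHx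
  -- `c H(x)^α ≥ |C| + 1`
  have hpow : (|C| + 1) / c ≤ P.hamiltonian N ((fun _ => s), 0) ^ α := by
    have h1 : R ^ α ≤ P.hamiltonian N ((fun _ => s), 0) ^ α := Real.rpow_le_rpow hR0 hHx hα.le
    have h2 : R ^ α = (|C| + 1) / c := by
      rw [hR, ← Real.rpow_mul (by positivity), one_div_mul_cancel hα.ne', Real.rpow_one]
    rw [h2] at h1
    exact h1
  have hcpow : |C| + 1 ≤ c * P.hamiltonian N ((fun _ => s), 0) ^ α := by
    have := mul_le_mul_of_nonneg_left hpow hc.le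
    rwa [mul_div_cancel₀ _ hc.ne'] at this
  -- at `x` the generator is pure heating, hence nonnegative
  have hLx : 0 ≤ P.generator N T_L T_R (fun y => F (P.hamiltonian N y)) ((fun _ => s), 0) := by
    rw [P.generator_comp_hamiltonian_zero_momenta hN hH hF hF' T_L T_R]
    exact mul_nonneg (mul_nonneg hγ.le hT.le) (hF'0 _ hHx0)
  have hx' := h ((fun _ => s), 0)
  have hC : C ≤ |C| := le_abs_self C
  linarith

end Literature.MathematicalPhysics.KineticTheory.HeatConduction.OscillatorChain

namespace Literature.Barriers.AtomisticToContinuum.HeatConduction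

open Literature.MathematicalPhysics.KineticTheory.HeatConduction

/-- **The Hairer–Mattingly chain admits no energy-only pointwise drift** (`k ≥ 1`, `γ > 0`,
`N ≥ 1`, `T_L + T_R > 0`, `F' ≥ 0` on `[0,∞)`, `c, α > 0`): `¬ ∀ x, L(F∘H)(x) ≤ C - cH(x)^α`.
[folklore] -/
theorem homogeneouslyPinnedChain_not_generator_comp_hamiltonian_le {k : ℝ} (hk : 1 ≤ k) {γ : ℝ}
    (hγ : 0 < γ) {N : ℕ} (hN : 0 < N) {T_L T_R : ℝ} (hT : 0 < T_L + T_R) {F F' F'' : ℝ → ℝ}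
    (hF : ∀ u, HasDerivAt F (F' u) u) (hF' : ∀ u, HasDerivAt F' (F'' u) u)
    (hF'0 : ∀ u, 0 ≤ u → 0 ≤ F' u) {C c α : ℝ} (hc : 0 < c) (hα : 0 < α) :
    ¬ ∀ x, (homogeneouslyPinnedChain k γ).generator N T_L T_R
        (fun y => F ((homogeneouslyPinnedChain k γ).hamiltonian N y)) x ≤
        C - c * (homogeneouslyPinnedChain k γ).hamiltonian N x ^ α := by
  have hk0 : 0 < k := by linarith
  refine (homogeneouslyPinnedChain k γ).not_generator_comp_hamiltonian_le hN
    (homogeneouslyPinnedChain_contDiff_U hk γ) ((homogeneouslyPinnedChain_contDiff_V k γ).of_le le_top)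
    (fun q => ?_) (fun r => ?_) (fun E => ?_) hγ hT hF hF' hF'0 hc hα
  · show 0 ≤ |q| ^ (2 * k) / (2 * k)
    exact div_nonneg (Real.rpow_nonneg (abs_nonneg q) _) (by linarith)
  · show 0 ≤ r ^ 2 / 2
    positivity
  · -- `U(s) = |s|^{2k}/2k ≥ |s|/2k - 1/(2k)·0 …`: take `s = 1 + 2k·max E 0`, where `|s| ≥ 1` gives `|s|^{2k} ≥ |s|`
    refine ⟨1 + 2 * k * max E 0, ?_⟩
    show E ≤ |1 + 2 * k * max E 0| ^ (2 * k) / (2 * k)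
    have hm : 0 ≤ max E 0 := le_max_right _ _
    have hs1 : 1 ≤ 1 + 2 * k * max E 0 := by nlinarith
    have habs : |1 + 2 * k * max E 0| = 1 + 2 * k * max E 0 := abs_of_pos (by linarith)
    rw [habs]
    have hpow : 1 + 2 * k * max E 0 ≤ (1 + 2 * k * max E 0) ^ (2 * k) := by
      have := Real.rpow_le_rpow_of_exponent_le hs1 (show (1 : ℝ) ≤ 2 * k by linarith)
      rwa [Real.rpow_one] at this
    rw [le_div_iff₀ (by linarith : (0 : ℝ) < 2 * k)]
    have hE : E ≤ max E 0 := le_max_left _ _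
    nlinarith

/-- **Nor does the conjunct's pinned anharmonic chain** `pinnedChain ω₂ lam β γ` (`ω₂ > 0`,
`lam, β ≥ 0`, `γ > 0`; condition C5 holds): the obstruction to POINTWISE exponential drift is not
specific to strong pinning. [folklore] -/
theorem pinnedChain_not_generator_comp_hamiltonian_le {ω₂ lam β γ : ℝ} (hω : 0 < ω₂) (hl : 0 ≤ lam)
    (hβ : 0 ≤ β) (hγ : 0 < γ) {N : ℕ} (hN : 0 < N) {T_L T_R : ℝ} (hT : 0 < T_L + T_R)
    {F F' F'' : ℝ → ℝ} (hF : ∀ u, HasDerivAt F (F' u) u) (hF' : ∀ u, HasDerivAt F' (F'' u) u)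
    (hF'0 : ∀ u, 0 ≤ u → 0 ≤ F' u) {C c α : ℝ} (hc : 0 < c) (hα : 0 < α) :
    ¬ ∀ x, (pinnedChain ω₂ lam β γ).generator N T_L T_R
        (fun y => F ((pinnedChain ω₂ lam β γ).hamiltonian N y)) x ≤
        C - c * (pinnedChain ω₂ lam β γ).hamiltonian N x ^ α := by
  have hU : ContDiff ℝ 1 (pinnedChain ω₂ lam β γ).U := by
    have : (pinnedChain ω₂ lam β γ).U = fun q => ω₂ * q ^ 2 / 2 + lam * q ^ 4 / 4 := rfl
    rw [this]
    fun_prop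
  have hV : ContDiff ℝ 1 (pinnedChain ω₂ lam β γ).V := by
    have : (pinnedChain ω₂ lam β γ).V = fun r => r ^ 2 / 2 + β * r ^ 4 / 4 := rfl
    rw [this]
    fun_prop
  refine (pinnedChain ω₂ lam β γ).not_generator_comp_hamiltonian_le hN hU hV
    (fun q => ?_) (fun r => ?_) (fun E => ?_) hγ hT hF hF' hF'0 hc hα
  · show 0 ≤ ω₂ * q ^ 2 / 2 + lam * q ^ 4 / 4
    positivity
  · show 0 ≤ r ^ 2 / 2 + β * r ^ 4 / 4
    positivity
  · -- `U(s) ≥ ω₂ s²/2 ≥ …`: take `s = 1 + max E 0 / ω₂`… simpler: `s = max E 0 + 2/ω₂` has `ω₂ s²/2 ≥ E`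
    refine ⟨max E 0 + 2 / ω₂, ?_⟩
    show E ≤ ω₂ * (max E 0 + 2 / ω₂) ^ 2 / 2 + lam * (max E 0 + 2 / ω₂) ^ 4 / 4
    have hm : 0 ≤ max E 0 := le_max_right _ _
    have hE : E ≤ max E 0 := le_max_left _ _
    have h2 : 0 < 2 / ω₂ := by positivity
    have hs : 0 ≤ max E 0 + 2 / ω₂ := by linarith
    have hl4 : 0 ≤ lam * (max E 0 + 2 / ω₂) ^ 4 / 4 := by positivity
    -- `ω₂ s²/2 ≥ ω₂ · s · (2/ω₂) / 2 = s ≥ max E 0`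
    have hsq : ω₂ * (max E 0 + 2 / ω₂) ^ 2 / 2 ≥ max E 0 := by
      have h1 : (max E 0 + 2 / ω₂) ^ 2 ≥ (max E 0 + 2 / ω₂) * (2 / ω₂) := by
        rw [sq]
        exact mul_le_mul_of_nonneg_left (by linarith) hs
      have h3 : ω₂ * ((max E 0 + 2 / ω₂) * (2 / ω₂)) / 2 = max E 0 + 2 / ω₂ := by
        field_simp
      have h4 : ω₂ * (max E 0 + 2 / ω₂) ^ 2 / 2 ≥ ω₂ * ((max E 0 + 2 / ω₂) * (2 / ω₂)) / 2 := by
        have := mul_le_mul_of_nonneg_left h1 hω.le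
        linarith
      linarith
    linarith

/-- In particular **`V = e^{θH}` has no pointwise geometric drift on the Hairer–Mattingly chain**
(`θ ≥ 0`): `¬ ∀ x, L e^{θH} ≤ C - cH^α`. [folklore] -/
theorem homogeneouslyPinnedChain_not_generator_exp_le {k : ℝ} (hk : 1 ≤ k) {γ : ℝ} (hγ : 0 < γ)
    {N : ℕ} (hN : 0 < N) {T_L T_R : ℝ} (hT : 0 < T_L + T_R) {θ : ℝ} (hθ : 0 ≤ θ) {C c α : ℝ}
    (hc : 0 < c) (hα : 0 < α) :
    ¬ ∀ x, (homogeneouslyPinnedChain k γ).generator N T_L T_R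
        (fun y => Real.exp (θ * (homogeneouslyPinnedChain k γ).hamiltonian N y)) x ≤
        C - c * (homogeneouslyPinnedChain k γ).hamiltonian N x ^ α := by
  have hF : ∀ u, HasDerivAt (fun u => Real.exp (θ * u)) (θ * Real.exp (θ * u)) u := fun u => by
    simpa [mul_comm] using ((hasDerivAt_id u).const_mul θ).exp
  have hF' : ∀ u, HasDerivAt (fun u => θ * Real.exp (θ * u)) (θ * (θ * Real.exp (θ * u))) u :=
    fun u => (hF u).const_mul θ
  exact homogeneouslyPinnedChain_not_generator_comp_hamiltonian_le hk hγ hN hT hF hF'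
    (fun u _ => mul_nonneg hθ (Real.exp_pos _).le) hc hα

end Literature.Barriers.AtomisticToContinuum.HeatConduction

/-! ### The narrowed barrier -/

namespace Literature.Barriers.AtomisticToContinuum

open Literature.MathematicalPhysics.KineticTheory.HeatConduction HeatConduction

/-- **Narrowed barrier (audit of `StrongPinningBreathers`, 2026-08-15): what Hairer–Mattingly 2009 PROVE about strongly pinned Langevin chains is spectral and lives in the Gibbs-weighted spaces `L²(e^{-βH}dp dq)`; the `(k, N)` regime map is sharper than "pinning stronger than coupling"; the `L²(μ)` gap, Harris / weighted-total-variation exponential ergodicity and convergence-rate lower bounds are covered by NO printed theorem (conjectured by the source); a pointwise generator drift for energy-only Lyapunov functions fails for EVERY chain.** Conjuncts, all PROVED (`StrongPinningBreathersNarrow_holds`): (1) the regime map of the source's decay exponent `γ(k,n) = 2n/k + 1 - 2n` (`breatherDecayExponent`; `Ḣ ≈ -(γ₀+γ_N)κ_{k,n}H^{γ}` for a breather `n` bonds from the nearest bath): for `k > 0`, `n ≥ 1`: `γ < 1 ↔ 1 < k` and `γ < 0 ↔ 2n/(2n-1) < k`; `γ(2,1) = 0`, `γ(2,2) = -1`;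 for `k > 1` every depth `n > k/(2(k-1))` has `γ < 0`; `2n/(2n-1) ≤ 4/3` for `n ≥ 2`; `centralDepth 3 = centralDepth 4 = 1`, `centralDepth 5 = centralDepth 6 = 2`; (2) `phi4Chain ω₂ lam γ' = homogeneouslyPinnedChain 2 γ ↔ ω₂ = 0 ∧ lam = 1 ∧ γ' = γ`; (3) for EVERY `OscillatorChain` with `C¹` nonnegative potentials, pinning unbounded above, `γ > 0`, `N ≥ 1` sites, `T_L + T_R > 0`, every `C²` function `F` with `F' ≥ 0` on `[0, ∞)` and all `C`, `c > 0`, `α > 0`: `¬ ∀ x, L(F∘H)(x) ≤ C - cH(x)^α` (because `L(F∘H)(q, 0) = γ(T_L+T_R)F'(H(q,0)) ≥ 0`) — for the Hairer–Mattingly chain and for the conjunct's `pinnedChain` alike.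
BARRIER (D-0021), AtomisticToContinuum/FouriersLaw — NARROWED form of the block on `HairerMattingly2009_threeOscillators`:
technique_class: compact-resolvent weighted-L2-spectral-gap gibbs-reference-weight hypocoercive-L2-with-gibbs-weight — arguments that would give the generator of the chain a compact resolvent, or make `0` an isolated eigenvalue of finite multiplicity with an exponentially stable invariant complement (semi-Fredholmness at `0`, spectral gap, `‖e^{tL̃}|‖ ≤ Ce^{-ct}` on the complement), on a Hilbert space `L²(e^{-βH}dp dq)` with a Gibbs-type reference weight, `β < 2 min{β₀, β_N}` (Eckmann–Pillet–Rey-Bellet 1999, Eckmann–Hairer 2000/2003, Helffer–Nier-type methods) [cite: HairerMattingly2009, Thm 3.11 and Rem 3.12 and Thm 3.13]; of the catalogued tokens `exponential-lyapunov-function geometric-drift-harris spectral-gap-hypocoercivity exponential-ergodicity` the printed theorems cover ONLY this weighted-`L²` sense; NOT covered by any printed theorem: (i) the spectral gap in `L²(μ)` for the invariant measure `μ` — "It is then a natural conjecture that the spectrum of the generator … on the `L²` space weighted by the invariant measure has the same behavior … The next section is a step towards a proof of this conjecture" [cite: HairerMattingly2009, §2.2 Claim 2], "it is very likely that the qualitative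 nature of the spectrum of `L` in `L²(μ)` is also the same" [cite: HairerMattingly2009, §3.2]; (ii) `V`-uniform (Harris) geometric ergodicity in weighted total variation — for `V = e^{θH}` or any other weight — and LOWER bounds on `‖P_t(x,·) - μ‖_TV`: the criterion exists [cite: Hairer2009, §3.3] and is printed only for the two-oscillator model with one bath at infinite temperature (matching upper and lower bounds: exponential for `1 < k ≤ 4/3`, stretched exponential for `4/3 ≤ k < 2`, algebraic at `k = 2`, no invariant probability measure for `k > 2`) [cite: Hairer2009, Thm 1.1] and for rotor chains [cite: CuneoPoquet2017, Thm 1.1]; "does not relax exponentially fast to this equilibrium" [cite: HairerMattingly2009, Abstract] and "can exhibit strictly subgeometric rates, as proved in [HM]" [cite: CuneoPoquet2017, §1] refer to the weighted-`L²` statement; (iii) a POINTWISE generator drift `LV ≤ C - cH^α` for energy-only `V = F(H)` is available for NO chain (conjunct (3)) — exponential Lyapunov arguments for Langevin chains are time-integrated (`P^tV ≤ λV + b` from `∫₀ᵗ ∑_b γ p_b² ds`, the generator identity being `L e^{θH} = θγ ∑_b (T_b + (θT_b - 1)p_b²) e^{θH}`) [cite: CuneoEckmannHairerReyBellet2018,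 §3 eq. (3.3)], and it is this integrated dissipation that a breather suppresses (`Ḣ ≈ -(γ₀+γ_N)κ_{k,n}H^{γ(k,n)}`, `γ(k,n) < 1` iff `k > 1`) [cite: HairerMattingly2009, §2.2 Claim 2]
blocks: with `N` = number of sites (HM's `N + 1`), `n = ⌊(N-1)/2⌋` (`centralDepth N`), pinning `|q|^{2k}/2k`, harmonic coupling, Langevin baths on sites `0` and `N - 1` at any `T₀, T_N > 0` (equal temperatures included) and any `β < 2 min{β₀, β_N}`: `N ∈ {3, 4}`: `k ≥ 2` ⇒ `L̃` has no compact resolvent, `k > 2` ⇒ `0 ∈ σ_e(L̃)` [cite: HairerMattingly2009, Thm 3.11 and Rem 3.12]; `N ≥ 5`: `k > 3/2` ⇒ `0 ∈ σ_e(L̃)`, `k = 3/2` ⇒ no compact resolvent [cite: HairerMattingly2009, Thm 3.13]; in particular for the `φ⁴` chain `phi4Chain 0 1 γ = homogeneouslyPinnedChain 2 γ` (`k = 2`): `N ∈ {3, 4}` loss of compactness ONLY, `N ≥ 5` no spectral gap in those spaces — so no `N`-uniform exponential relaxation in those spaces for any `k > 3/2`; NOTHING is printed (no theorem either way) for `N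 ∈ {3, 4}` with `1 < k < 2` — where the source's model predicts a COMPACT RESOLVENT (`γ(k,1) = 2/k - 1 ∈ (0, 1)`) — nor for `N ≥ 5` with `1 < k < 3/2` (model: gapless iff `k > 2n/(2n-1)`, and `2n/(2n-1) ≤ 4/3 < 3/2`, conjunct (1)) [cite: HairerMattingly2009, §2.2 Claim 2]; for `k = 2`, `N ∈ {3, 4}` a SPECTRAL GAP WITHOUT compact resolvent is the model prediction (`γ = 0`: "does not have compact resolvent, but it still has a spectral gap") [cite: HairerMattingly2009, §2.2 Claim 2]; the members `phi4Chain ω₂ lam γ`, `ω₂ > 0`, of the `φ⁴` family (conjunct (2)) are covered only by "One would expect these scaling relations to hold at high energies, even if the potentials are not exactly homogeneous" [cite: HairerMattingly2009, Rem 2.2]; clause (i) of `OscillatorChain.FouriersLawFor` (a unique steady state for EVERY `N`) for such chains is OPEN, not blocked: existence is printed for `N = 3`, `k > 3/2` [cite: HairerMattingly2009, Thm 5.6 and Prop 5.1], and "when the pinning dominates, the mixing is proven only for a chain of `N = 3` oscillators" [cite: DymovLokutsievskiySarychev2024, §5]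
because: breathers — a site `n` bonds away from the baths holding energy `H` forces the bath sites only through fast oscillations of frequency `H^{α}`, `α = 1/2 - 1/2k`, and amplitude `H^{1/2k-(2n-1)α}` that average out, so `Ḣ ≈ -(γ₀+γ_N)κ_{k,n}H^{2n/k+1-2n}` [cite: HairerMattingly2009, §2.2 Claim 2]; Gibbs densities at the ends, corrected by the Poisson-equation compensators `Φ`, `Φ^{(2)}` and localised on such states, are Weyl sequences for `L̃` and `L̃*` (approximate invariant measures) [cite: HairerMattingly2009, Thm 3.11 and Thm 3.13]
evasions_known: (a)–(d) of the catalogued block stand [cite: HairerMattingly2009, Thm 5.6 and Prop 5.1] [cite: CuneoEckmannPoquet2015, Abstract] [cite: CuneoEckmann2016, Abstract] [cite: CuneoPoquet2017, Abstract] [cite: Hairer2009, Thm 1.1] [cite: CuneoEckmannHairerReyBellet2018, Thm 2.13]; opened or made explicit by this audit: (e) `N ∈ {3, 4}` sites with `k = 2` (the `φ⁴` chain) or `1 < k < 2`: exponential convergence (a spectral gap, resp. a compact resolvent) is PREDICTED by the source's own model and contradicted by no theorem [cite: HairerMattingly2009, §2.2 Claim 2]; (f) Harris-type theorems with weights that are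 NOT functions of `H` alone — breather-corrected weights `exp(θ(energy + correctors))`, cf. "`L exp(θ𝒰₀) ≤ C - α exp(θ𝒰₀)`" for the corrected OUTER energies [cite: HairerMattingly2009, Rem 5.4] — and subgeometric (Douc–Fort–Guillin) drifts `L𝒱 ≤ C₁ - C₂𝒱^a`, rate `t^{-a/(1-a)}` in total variation [cite: HairerMattingly2009, Rem 5.2], with the corrector expansion giving `L𝒰₁ ≤ -cH^{n+2/k-2} + C𝒰₀^N` (`𝒰₁ ∼ H^n`, any `n`) for `3/2 < k < 2` [cite: HairerMattingly2009, Thm 5.6]; (g) the lower-bound criterion of [cite: Hairer2009, §3.3] fed with the effective dynamics behind [cite: HairerMattingly2009, Thm 5.6] is the natural, unwritten route to UPGRADE this barrier to a total-variation statement (it is how [cite: CuneoPoquet2017, Thm 1.1] treats rotors)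
scope_caveats: (a) PROVED content = the weighted-`L²(e^{-βH})` spectral statements listed under `blocks`, for the homogeneous model only; everything about `L²(μ)`, Harris / total-variation rates and "no exponential relaxation" in other norms is heuristic in the source (the one-dimensional diffusion model and Claim 2 of §2.2, the numerics of §2.1) or printed for OTHER models (the infinite-temperature toy model [cite: Hairer2009, Thm 1.1], rotor chains [cite: CuneoPoquet2017, Thm 1.1]); (b) the regime map `γ(k,n)` is the source's HEURISTIC — conjunct (1) is arithmetic about it, not a theorem about the chain; the even-chain rule is garbled in the arXiv text of §2 ("the chain of length `2n+1`") and is fixed here by Rem 3.12 (four oscillators behave like three: `centralDepth 4 = 1`) [cite: HairerMattingly2009, Rem 3.12]; (c) conjunct (3) is elementary and model-independent: it says that "exponential Lyapunov function `LV ≤ -cV`" must be read as an integrated drift, NOT that integrated drifts fail — for condition-C5 chains they hold [cite: CuneoEckmannHairerReyBellet2018, Thm 2.13]; (d) every caveat of the catalogued block stands: nothing is asserted about the conjunct's `pinnedChain ω₂ lam β γ`, `β > 0`; the spectral theorems are cited, not restated in Lean (Mathlib has no essential spectrum for unbounded non-self-adjoint operators); the Lean fact `HairerMattingly2009_threeOscillators`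 records only the positive `N = 3` theorem (its discharge is in progress in `StrongPinningBreathersLyapunov.lean` and `StrongPinningBreathersSemigroup.lean`)
status: theorem (established) for the weighted-`L²` statements [cite: HairerMattingly2009, Thm 3.11 and Thm 3.13]; conjectural for `L²(μ)`, Harris / total variation and quantitative rates [cite: HairerMattingly2009, §2.2 Claim 2] [cite: Hairer2009, Thm 1.1]; existence for `N ≥ 4` open [cite: HairerMattingly2009, §1] [cite: CuneoEckmannHairerReyBellet2018, §1 (paragraph after condition C5)] [cite: DymovLokutsievskiySarychev2024, §5] [cite: LuJianfeng2026LSI, §1 Related work]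
[cite: HairerMattingly2009, Thm 3.11 and Thm 3.13 and §2.2 Claim 2] -/
def StrongPinningBreathersNarrow : Prop :=
  -- (1) the regime map of the decay exponent `γ(k,n) = 2n/k + 1 - 2n`
  (∀ k : ℝ, 0 < k → ∀ n : ℕ, 1 ≤ n → (breatherDecayExponent k n < 1 ↔ 1 < k)) ∧
  (∀ k : ℝ, 0 < k → ∀ n : ℕ, 1 ≤ n → (breatherDecayExponent k n < 0 ↔ 2 * n / (2 * n - 1) < k)) ∧
  (breatherDecayExponent 2 1 = 0 ∧ breatherDecayExponent 2 2 = -1) ∧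
  (∀ k : ℝ, 1 < k → ∀ n : ℕ, k / (2 * (k - 1)) < n → breatherDecayExponent k n < 0) ∧
  (∀ n : ℕ, 2 ≤ n → (2 * n : ℝ) / (2 * n - 1) ≤ 4 / 3) ∧
  (centralDepth 3 = 1 ∧ centralDepth 4 = 1 ∧ centralDepth 5 = 2 ∧ centralDepth 6 = 2) ∧
  -- (2) the printed theorems concern the `ω₂ = 0`, `lam = 1` corner of the `φ⁴` family
  (∀ ω₂ lam γ γ' : ℝ,
    phi4Chain ω₂ lam γ' = homogeneouslyPinnedChain 2 γ ↔ ω₂ = 0 ∧ lam = 1 ∧ γ' = γ) ∧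
  -- (3) energy-only Lyapunov functions never have a pointwise generator drift, for ANY chain
  (∀ (P : OscillatorChain) (N : ℕ), 0 < N → ContDiff ℝ 1 P.U → ContDiff ℝ 1 P.V →
    (∀ q, 0 ≤ P.U q) → (∀ r, 0 ≤ P.V r) → (∀ E : ℝ, ∃ s : ℝ, E ≤ P.U s) → 0 < P.γ →
    ∀ T_L T_R : ℝ, 0 < T_L + T_R →
    ∀ F F' F'' : ℝ → ℝ, (∀ u, HasDerivAt F (F' u) u) → (∀ u, HasDerivAt F' (F'' u) u) →
    (∀ u, 0 ≤ u → 0 ≤ F' u) → ∀ C c α : ℝ, 0 < c → 0 < α →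
      ¬ ∀ x, P.generator N T_L T_R (fun y => F (P.hamiltonian N y)) x ≤
          C - c * P.hamiltonian N x ^ α)

/-- **The narrowed barrier holds** (every conjunct is a theorem of this file).
[cite: HairerMattingly2009, §2.2 Claim 2] -/
theorem StrongPinningBreathersNarrow_holds : StrongPinningBreathersNarrow :=
  ⟨fun _ hk _ hn => breatherDecayExponent_lt_one_iff hk hn,
    fun _ hk _ hn => breatherDecayExponent_neg_iff hk hn,
    ⟨breatherDecayExponent_two_one, breatherDecayExponent_two_two⟩,
    fun _ hk _ hn => breatherDecayExponent_neg_of_lt hk hn,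
    fun _ hn => threshold_le_four_thirds hn,
    ⟨centralDepth_three, centralDepth_four, centralDepth_five, centralDepth_six⟩,
    phi4Chain_eq_homogeneouslyPinnedChain_two_iff,
    fun P _ hN hU hV hU0 hV0 hUunb hγ _ _ hT _ _ _ hF hF' hF'0 _ _ _ hc hα =>
      P.not_generator_comp_hamiltonian_le hN hU hV hU0 hV0 hUunb hγ hT hF hF' hF'0 hc hα⟩

end Literature.Barriers.AtomisticToContinuum

end
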